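import Mathlib
import Literature.Analysis.FluidPDE.ClassicalSolution
import Literature.Analysis.FluidPDE.VectorCalculus
import Literature.Analysis.FluidPDE.SelfSimilar
import HarnessLib

/-!
# Route `ThreadingFlux` / `UnthreadedDoor`, crux `PoloidalLiouville` (stmt-NavierStokesRegularity-1222), WALL W1 —
# crux idea «horizon-threading-tower» (planner ns-idea-15; ns-wall-crit-1 verdict V9 PASS-WITH-PRICE):
# THE TYPED OBJECTS AND STATEMENTS of the line (Theorems-side twin of the sketch)

Definition file (Theorems-side twin of the crux sketch `Cruxes/PoloidalLiouville/HorizonTowerSketch.lean`, tree sha12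
842f7e3e8255, 2026-08-28; namespace `…Theorems.PoloidalLiouville.HorizonTower` instead of the sketch's
`…Cruxes.PoloidalLiouville.HorizonTower`; every def BODY below is VERBATIM; the sketch's `import …Theses.ThreadingFlux` is
dropped — no body uses a Theses symbol; `Literature.Analysis.FluidPDE.SelfSimilar` is imported for `IsBoundedAncientMildSolution`).  Purpose: kernel theorems about the line (`HorizonTower.orderOneFluxIdentity` /
`headVirialIdentity`, p661847; the poloidal-field calculus p664238; `HorizonProfileStructure` in preparation) can be stated BY NAME
from `Theorems/` without importing a crux workfile (same device as `UnthreadedDoorNetFluxDefs.lean`, `UnthreadedDoorCapSymDefs.lean`).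

Objects: `threadingFlux`, `radialVirial`, `head`, `loc2`, `IsZeroHomogeneousAbout`, `horizonL1`, `horizonL2`, `horizonProfile`,
`shellSlice`, `HasEndpointTail`, `IsShapeTensor`, `IsBlowdownLimit`.  Statements: `HeadVirialIdentity`, `OrderOneFluxIdentity`,
`SecondJetHeadForm`, `HorizonProfileStructure`, `OrderOneSphereEuler`, `OrderTwoHorizonLaw`, `OrderTwoHorizonLawBlowdown`,
`HorizonSieve`, the table `HorizonL2Quadrupole` / `HorizonL2Tetrahedral` / `HorizonL2Octahedral` / `HorizonL2Zonal`, the typed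
obstruction `HorizonZonalitySingleDegree` / `HorizonTowerZonality`, and the rungs `BoundedEndpointShellRung(Datum)` /
`BoundedEndpointTailRung`.

WHAT THIS IS NOT: no NS-regularity statement is touched; `PoloidalLiouville` (1222) and `UnthreadedRigidity` (27585) stay OPEN; these
are the objects of one crux idea (the conjectures among them are labelled so in their docstrings).  `--supports
stmt-NavierStokesRegularity-1222 --as helper`.  Author of the statements: planner ns-idea-15; filed Theorems-side by ARM A
ns-exp-scalarLiouville g3.  [cite: MajdaBertozziCUP2002, §1.1 (vector identities)]
-/

noncomputable section

-- the summit and its single sub-problem share the name (CONVENTIONS §1)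
set_option linter.dupNamespace false

namespace Summit.NavierStokesRegularity.NavierStokesRegularity.Theorems.PoloidalLiouville.HorizonTower

open scoped Topology
open Filter Set MeasureTheory
open Literature.Analysis.FluidPDE (cross curl)

/-- ℝ³. -/
abbrev E3 : Type := EuclideanSpace ℝ (Fin 3)

/-- Threading flux `F(t,x) = ⟪curl u(t) x, x − x₀⟫`. -/
def threadingFlux (u : ℝ → E3 → E3) (x₀ : E3) (t : ℝ) (x : E3) : ℝ :=
  inner ℝ (curl (u t) x) (x - x₀)

/-- Radial virial `(y·∇)B` of a scalar about `x₀`. -/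
def radialVirial (B : E3 → ℝ) (x₀ : E3) (x : E3) : ℝ := inner ℝ (x - x₀) (gradient B x)

/-- Bernoulli head `B = p + |u|²/2` of a slice. -/
def head (u : E3 → E3) (p : E3 → ℝ) (x : E3) : ℝ := p x + ‖u x‖ ^ 2 / 2

/-- LOCAL part of the order-two threading coefficient (viscosity 1): with `ω = curl u`, `λ = u × ω`,
`a = λ + Δu` (= `∂ₜu + ∇B`), `N = curl λ + Δω` (= `∂ₜω`):  `Loc₂[u](x) = ⟪y, curl(a × ω) + curl(u × N) + ΔN⟫`. -/
def loc2 (u : E3 → E3) (x₀ : E3) (x : E3) : ℝ :=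
  inner ℝ (x - x₀)
    (curl (fun z => cross (cross (u z) (curl u z) + Laplacian.laplacian u z) (curl u z)) x
      + curl (fun z => cross (u z)
          (curl (fun w => cross (u w) (curl u w)) z + Laplacian.laplacian (curl u) z)) x
      + Laplacian.laplacian (fun z => curl (fun w => cross (u w) (curl u w)) z + Laplacian.laplacian (curl u) z) x)

/-- Degree-0 homogeneity about `x₀` (scale-free far-field profiles). -/
def IsZeroHomogeneousAbout (x₀ : E3) (U : E3 → E3) : Prop :=
  ∀ c : ℝ, 0 < c → ∀ y : E3, U (x₀ + c • y) = U (x₀ + y)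

/-- ORDER-ONE HORIZON LAW `𝔏₁[U](x) = r ⟪y, curl(U × curl U)⟫` (degree 0 when `U` is degree-0 homogeneous). -/
def horizonL1 (U : E3 → E3) (x₀ : E3) (x : E3) : ℝ :=
  ‖x - x₀‖ * inner ℝ (x - x₀) (curl (fun z => cross (U z) (curl U z)) x)

/-- ORDER-TWO HORIZON LAW `𝔏₂[U](x) = r² ⟪y, curl((U×Ω)×Ω) + curl(U × curl(U×Ω))⟫`, `Ω = curl U`: the purely inertial,
LOCAL leading far-field term of `c₂` for scale-free slices (the head term drops by the head–virial identity). -/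
def horizonL2 (U : E3 → E3) (x₀ : E3) (x : E3) : ℝ :=
  ‖x - x₀‖ ^ 2 * inner ℝ (x - x₀)
    (curl (fun z => cross (cross (U z) (curl U z)) (curl U z)) x
      + curl (fun z => cross (U z) (curl (fun w => cross (U w) (curl U w)) z)) x)

/-- The degree-`l` HORIZON PROFILE of a degree-`l` solid harmonic `H`: `U = curl curl (r^{1−l} H(y) y)` — the degree-0
homogeneous (bounded, non-decaying) member of the single-degree poloidal shell family (`h(r) = r^{1−l}`). -/
def horizonProfile (l : ℕ) (H : E3 → ℝ) (x₀ : E3) : E3 → E3 :=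
  curl (curl (fun z : E3 => (‖z - x₀‖ ^ ((1 : ℤ) - l) * H (z - x₀)) • (z - x₀)))

/-- The single-degree poloidal shell slice with radial profile `h`: `u = curl curl (h(r) H(y) y)`. -/
def shellSlice (h : ℝ → ℝ) (H : E3 → ℝ) (x₀ : E3) : E3 → E3 :=
  curl (curl (fun z : E3 => (h ‖z - x₀‖ * H (z - x₀)) • (z - x₀)))

/-- Bounded-endpoint tail `h = c r^{1−l} + O(r^{1−l−δ})` with eight derivatives (`Loc₂` differentiates the slice six times,
the slice differentiates `h` twice): the slice is bounded and does NOT decay. -/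
def HasEndpointTail (l : ℕ) (h : ℝ → ℝ) (c : ℝ) : Prop :=
  c ≠ 0 ∧ ∃ δ C : ℝ, 0 < δ ∧ ∀ k ≤ 8, ∀ t : ℝ, 1 ≤ t →
    |iteratedDeriv k (fun s => h s - c * s ^ ((1 : ℤ) - l)) t| ≤ C * t ^ (-((l : ℝ) - 1 + k + δ))

/-- Traceless symmetric shape tensor. -/
def IsShapeTensor (Q : E3 →L[ℝ] E3) : Prop :=
  (∀ a b : E3, inner ℝ (Q a) b = inner ℝ a (Q b)) ∧ LinearMap.trace ℝ E3 (Q : E3 →ₗ[ℝ] E3) = 0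

/-! ## First lemmas (provable now) -/

/-- HEAD–VIRIAL IDENTITY (S; pure vector calculus, engine E1): for `ω` tangent to the spheres about `x₀` and divergence
free, and any `C²` scalar `B`, `⟪y, curl(∇B × ω)⟫ = ⟪ω, ∇((y·∇)B)⟫`. -/
def HeadVirialIdentity : Prop :=
  ∀ (ω : E3 → E3) (B : E3 → ℝ) (x₀ : E3), ContDiff ℝ 1 ω → ContDiff ℝ 2 B →
    (∀ x, inner ℝ (ω x) (x - x₀) = 0) → Literature.Analysis.FluidPDE.VectorCalculus.IsDivFree ω →
    ∀ x, inner ℝ (x - x₀) (curl (fun z => cross (gradient B z) (ω z)) x)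
      = inner ℝ (ω x) (gradient (radialVirial B x₀) x)

/-- ORDER-ONE FLUX IDENTITY (S): for an unthreaded slice, `⟪y, curl(u × ω)⟫ = ⟪ω, ∇m⟫`, `m = ⟪u, y⟫` (so `c₁ = ω·∇m`:
the radial momentum is a first integral along vortex lines iff the slice is unthreaded to order one). -/
def OrderOneFluxIdentity : Prop :=
  ∀ (u : E3 → E3) (x₀ : E3), ContDiff ℝ 2 u → (∀ x, inner ℝ (curl u x) (x - x₀) = 0) →
    ∀ x, inner ℝ (x - x₀) (curl (fun z => cross (u z) (curl u z)) x)
      = inner ℝ (curl u x) (gradient (fun z => inner ℝ (u z) (z - x₀)) x)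

/-- SECOND-JET HEAD FORM (M): for a classical NS solution (ν = 1, no force) unthreaded at `t₀`,
`∂ₜ²F(t₀,x) = Loc₂[u(t₀)](x) − ⟪ω, ∇(r∂ᵣB)⟫`, `B = p(t₀) + |u(t₀)|²/2` — the pressure enters `c₂` only through the
radial virial of the head along vortex lines. -/
def SecondJetHeadForm : Prop :=
  ∀ (S : Set ℝ) (u : ℝ → E3 → E3) (p : ℝ → E3 → ℝ) (x₀ : E3) (t₀ : ℝ), IsOpen S → t₀ ∈ S →
    Literature.Analysis.FluidPDE.IsClassicalNSSolutionOn S 1 0 u p →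
    (∀ x, threadingFlux u x₀ t₀ x = 0) →
    ∀ x, iteratedDeriv 2 (fun t => threadingFlux u x₀ t x) t₀
      = loc2 (u t₀) x₀ x - inner ℝ (curl (u t₀) x) (gradient (radialVirial (head (u t₀) (p t₀)) x₀) x)

/-- HORIZON PROFILE STRUCTURE (S–M, engine E2/E3): for a degree-`l` solid harmonic `H` (`l ≥ 1`) the horizon profile
`U = curl curl(r^{1−l}H y)` is degree-0 homogeneous, divergence free and unthreaded on `ℝ³ ∖ {0}`; its radial part is
`f = l(l+1) H/r^l`, `U = f ξ + r ∇Φ` with `Φ = 2H/r^l` and `r²ΔΦ = −2f`; and `𝔏₁[U] ≡ 0`. -/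
def HorizonProfileStructure : Prop :=
  ∀ (l : ℕ) (H : E3 → ℝ), 1 ≤ l → ContDiff ℝ (⊤ : ℕ∞) H → (∀ (c : ℝ) (y : E3), H (c • y) = c ^ l * H y) →
    (∀ y, Laplacian.laplacian H y = 0) →
    IsZeroHomogeneousAbout 0 (horizonProfile l H 0) ∧
    (∀ x : E3, x ≠ 0 → Literature.Analysis.FluidPDE.VectorCalculus.divergence (horizonProfile l H 0) x = 0) ∧
    (∀ x : E3, x ≠ 0 → inner ℝ (curl (horizonProfile l H 0) x) x = 0) ∧
    (∀ x : E3, x ≠ 0 → horizonProfile l H 0 x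
        = ((l * (l + 1) : ℝ) * H x / ‖x‖ ^ l / ‖x‖) • x + ‖x‖ • gradient (fun z : E3 => 2 * H z / ‖z‖ ^ l) x) ∧
    (∀ x : E3, x ≠ 0 → ‖x‖ ^ 2 * Laplacian.laplacian (fun z : E3 => 2 * H z / ‖z‖ ^ l) x
        = -2 * ((l * (l + 1) : ℝ) * H x / ‖x‖ ^ l)) ∧
    (∀ x : E3, x ≠ 0 → horizonL1 (horizonProfile l H 0) 0 x = 0)

/-- ORDER-ONE HORIZON LAW = STEADY EULER ON THE SPHERE (M, engine E3b): for a smooth degree-0 homogeneous, divergence-free,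
unthreaded profile `U` with radial part `f = ⟪U, ξ⟫` and tangential potential `Φ` (`r²ΔΦ = −2f`),
`𝔏₁[U] = −r ⟪y, ∇f × ∇Φ⟫`; so `𝔏₁ ≡ 0` iff `{Δ_S Φ, Φ} = 0`, i.e. `Φ` is a stationary 2D-Euler stream function on `S²`. -/
def OrderOneSphereEuler : Prop :=
  ∀ (U : E3 → E3) (f Φ : E3 → ℝ) (x₀ : E3),
    ContDiffOn ℝ (⊤ : ℕ∞) U {x₀}ᶜ → ContDiffOn ℝ (⊤ : ℕ∞) Φ {x₀}ᶜ →
    IsZeroHomogeneousAbout x₀ U → (∀ c : ℝ, 0 < c → ∀ y : E3, Φ (x₀ + c • y) = Φ (x₀ + y)) →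
    (∀ x, x ≠ x₀ → Literature.Analysis.FluidPDE.VectorCalculus.divergence U x = 0) →
    (∀ x, x ≠ x₀ → inner ℝ (curl U x) (x - x₀) = 0) →
    (∀ x, x ≠ x₀ → f x = inner ℝ (U x) (x - x₀) / ‖x - x₀‖) →
    (∀ x, x ≠ x₀ → ‖x - x₀‖ ^ 2 * Laplacian.laplacian Φ x = -2 * f x) →
    ∀ x, x ≠ x₀ → horizonL1 U x₀ x = -‖x - x₀‖ * inner ℝ (x - x₀) (cross (gradient f x) (gradient Φ x))

/-- ORDER-TWO HORIZON LAW (M–L; the lever): a classical NS solution whose slice at `t₀` is unthreaded and has a scale-free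
far field — `u(t₀) = U + O(r^{−δ})` with six derivatives, `p(t₀) = P₀ + s₀ log r + O(r^{−δ})` with two derivatives,
`U`, `P₀` degree-0 homogeneous — satisfies `ρ² ∂ₜ²F(t₀, x₀ + ρξ) → 𝔏₂[U](ξ)` as `ρ → ∞`: at the horizon the order-two
threading coefficient is LOCAL and pressure-free. -/
def OrderTwoHorizonLaw : Prop :=
  ∀ (S : Set ℝ) (u : ℝ → E3 → E3) (p : ℝ → E3 → ℝ) (x₀ : E3) (t₀ : ℝ) (U : E3 → E3) (P₀ : E3 → ℝ) (s₀ δ C : ℝ),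
    IsOpen S → t₀ ∈ S → Literature.Analysis.FluidPDE.IsClassicalNSSolutionOn S 1 0 u p → 0 < δ →
    ContDiffOn ℝ (⊤ : ℕ∞) U {x₀}ᶜ → IsZeroHomogeneousAbout x₀ U →
    ContDiffOn ℝ (⊤ : ℕ∞) P₀ {x₀}ᶜ → (∀ c : ℝ, 0 < c → ∀ y : E3, P₀ (x₀ + c • y) = P₀ (x₀ + y)) →
    (∀ k ≤ 6, ∀ x : E3, 1 ≤ ‖x - x₀‖ →
        ‖iteratedFDeriv ℝ k (fun z => u t₀ z - U z) x‖ ≤ C * ‖x - x₀‖ ^ (-((k : ℝ) + δ))) →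
    (∀ k ≤ 2, ∀ x : E3, 1 ≤ ‖x - x₀‖ →
        ‖iteratedFDeriv ℝ k (fun z => p t₀ z - P₀ z - s₀ * Real.log ‖z - x₀‖) x‖ ≤ C * ‖x - x₀‖ ^ (-((k : ℝ) + δ))) →
    (∀ x, threadingFlux u x₀ t₀ x = 0) →
    ∀ ξ : E3, ‖ξ‖ = 1 →
      Tendsto (fun ρ : ℝ => ρ ^ 2 * iteratedDeriv 2 (fun t => threadingFlux u x₀ t (x₀ + ρ • ξ)) t₀) atTop
        (𝓝 (horizonL2 U x₀ (x₀ + ξ)))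

/-- BLOW-DOWN DATA of a slice `(w, q)` about `x₀`: along some `λₖ → ∞` the rescaled slice `y ↦ w (x₀ + λₖ y)` converges to `U`
with six derivatives, uniformly on compact subsets of `ℝ³ ∖ {0}`, and the rescaled pressure converges to `P` modulo constants `cₖ` with
two derivatives.  (No rate, no power remainder: slowly modulated far fields — e.g. `log log`-modulated ones — have such limit points;
only far fields modulated at unit rate in `log r` (discretely self-similar horizons) have none that are homogeneous.) -/
def IsBlowdownLimit (w : E3 → E3) (q : E3 → ℝ) (x₀ : E3) (U : E3 → E3) (P : E3 → ℝ) : Prop :=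
  ∃ (lam : ℕ → ℝ) (c : ℕ → ℝ), Tendsto lam atTop atTop ∧
    (∀ K : Set E3, IsCompact K → (0 : E3) ∉ K → ∀ j ≤ 6,
      Tendsto (fun k => sSup ((fun y => ‖iteratedFDeriv ℝ j (fun z : E3 => w (x₀ + lam k • z) - U z) y‖) '' K))
        atTop (𝓝 0)) ∧
    (∀ K : Set E3, IsCompact K → (0 : E3) ∉ K → ∀ j ≤ 2,
      Tendsto (fun k => sSup ((fun y => ‖iteratedFDeriv ℝ j (fun z : E3 => q (x₀ + lam k • z) - c k - P z) y‖) '' K))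
        atTop (𝓝 0))

/-- ORDER-ONE/TWO HORIZON LAWS, BLOW-DOWN FORM (M–L; the general sieve): if a classical NS solution is unthreaded about `x₀` on an
open window and a slice has a blow-down limit `(U, P₀ + s₀ log r)` with `U`, `P₀` degree-0 homogeneous, then `𝔏₁[U] ≡ 0` and
`𝔏₂[U] ≡ 0`.  Proof sketch: `λₖ² c₂(x₀ + λₖ y) = ⟪y, V[uₖ]⟫(y) − ⟪curl uₖ, ∇(r∂ᵣBₖ)⟫(y) + O(λₖ⁻²)` by scaling each term of
`SecondJetHeadForm`; the head term tends to `⟪Ω, ∇(r∂ᵣ(P₀ + s₀ log r + |U|²/2))⟫ = ⟪Ω, ∇ s₀⟫ = 0`. -/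
def OrderTwoHorizonLawBlowdown : Prop :=
  ∀ (S : Set ℝ) (u : ℝ → E3 → E3) (p : ℝ → E3 → ℝ) (x₀ : E3) (t₀ : ℝ) (U : E3 → E3) (P₀ : E3 → ℝ) (s₀ : ℝ),
    IsOpen S → t₀ ∈ S → Literature.Analysis.FluidPDE.IsClassicalNSSolutionOn S 1 0 u p →
    (∀ t ∈ S, ∀ x, threadingFlux u x₀ t x = 0) →
    IsZeroHomogeneousAbout 0 U → (∀ c : ℝ, 0 < c → ∀ y : E3, P₀ (c • y) = P₀ y) →
    IsBlowdownLimit (u t₀) (p t₀) x₀ U (fun y : E3 => P₀ y + s₀ * Real.log ‖y‖) →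
    ∀ y : E3, y ≠ 0 → horizonL1 U 0 y = 0 ∧ horizonL2 U 0 y = 0

/-- HORIZON SIEVE (the W1-level typed constraint on counterexamples; M–L given the blow-down law and the bridge
`Theorems.PoloidalLiouville.exists_isClassicalNSSolutionOn_Ioo`): under the hypotheses of `PoloidalLiouville` itself, with `p` any
classical pressure of `v` on `(−∞, 0)`, EVERY homogeneous blow-down limit of EVERY slice is annihilated by both horizon laws.
SCOPE (V9-P2, v2): the sieve binds ONLY counterexamples possessing a `C⁶` blow-down limit (`IsBlowdownLimit`), i.e. slices with a
SCALE-FREE far field in the quantitative sense `‖∇ʲ v(t₀, x)‖ ≲ ‖x − x₀‖^{−j}` for `j ≤ 6` (modulation rate in `log r` tending to 0);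
a general bounded ancient solution has bounded — not `O(1/r^j)` — derivatives and need not have any such limit point: there the sieve
is SILENT (it is a constraint on the scale-free cell, not on the bounded class). -/
def HorizonSieve : Prop :=
  ∀ (v : ℝ → E3 → E3) (p : ℝ → E3 → ℝ) (x₀ : E3),
    Literature.Analysis.FluidPDE.IsBoundedAncientMildSolution 1 v →
    Literature.Analysis.FluidPDE.IsClassicalNSSolutionOn (Set.Iio 0) 1 0 v p →
    (∀ t < 0, ∀ x, inner ℝ (x - x₀) (curl (v t) x) = 0) →
    ∀ t₀ < 0, ∀ (U : E3 → E3) (P₀ : E3 → ℝ) (s₀ : ℝ),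
      IsZeroHomogeneousAbout 0 U → (∀ c : ℝ, 0 < c → ∀ y : E3, P₀ (c • y) = P₀ y) →
      IsBlowdownLimit (v t₀) (p t₀) x₀ U (fun y : E3 => P₀ y + s₀ * Real.log ‖y‖) →
      ∀ y : E3, y ≠ 0 → horizonL1 U 0 y = 0 ∧ horizonL2 U 0 y = 0

/-! ## The table (exact algebraic identities, engine E4; each decidable by symbolic algebra) -/

/-- Degree 2: `𝔏₂[U_Q] = −256 det(y, Qy, Q²y)/r³` for `H = ⟪y,Qy⟫` — zero iff `Q` is uniaxial (axisymmetric shell).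
(This is the bounded endpoint `σ = 1` of the g0 card: `Z(1) = −64`, here identified as purely local/inertial.) -/
def HorizonL2Quadrupole : Prop :=
  ∀ Q : E3 →L[ℝ] E3, IsShapeTensor Q →
    ∀ x : E3, x ≠ 0 → horizonL2 (horizonProfile 2 (fun y : E3 => inner ℝ y (Q y)) 0) 0 x
      = -256 * inner ℝ x (cross (Q x) (Q (Q x))) / ‖x‖ ^ 3

/-- Degree 3, tetrahedral class `H = xyz` (which ESCAPES the far-field quadrupole law: `N(H) = 0`): the horizon law
threads it at order two, `𝔏₂ = 80 (x²−y²)(x²−z²)(y²−z²)/r⁶` (the product of the six diagonal mirror planes). -/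
def HorizonL2Tetrahedral : Prop :=
  ∀ x : E3, x ≠ 0 → horizonL2 (horizonProfile 3 (fun y : E3 => y 0 * y 1 * y 2) 0) 0 x
    = 80 * ((x 0) ^ 2 - (x 1) ^ 2) * ((x 0) ^ 2 - (x 2) ^ 2) * ((x 1) ^ 2 - (x 2) ^ 2) / ‖x‖ ^ 6

/-- Degree 4, octahedral class `H = 5(x⁴+y⁴+z⁴) − 3r⁴` (isotropic: `N(H) = 0`): threads at order two,
`𝔏₂ = 3456000 · xyz (x²−y²)(x²−z²)(y²−z²)/r⁹` (the product of the nine mirror planes of `O_h`). -/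
def HorizonL2Octahedral : Prop :=
  ∀ x : E3, x ≠ 0 →
    horizonL2 (horizonProfile 4 (fun y : E3 => 5 * ((y 0) ^ 4 + (y 1) ^ 4 + (y 2) ^ 4) - 3 * ‖y‖ ^ 4) 0) 0 x
    = 3456000 * (x 0 * x 1 * x 2) * ((x 0) ^ 2 - (x 1) ^ 2) * ((x 0) ^ 2 - (x 2) ^ 2) * ((x 1) ^ 2 - (x 2) ^ 2)
        / ‖x‖ ^ 9

/-- Zonal profiles are annihilated (S; axisymmetric-no-swirl far fields never thread: `Ω` is azimuthal, `U×Ω` and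
`(U×Ω)×Ω` are meridional, their curls azimuthal, so `⟪y, ·⟫ = 0`; engine-verified for degrees 2, 3, 4). -/
def HorizonL2Zonal : Prop :=
  ∀ (l : ℕ) (a : E3) (g : ℝ → ℝ), 2 ≤ l → a ≠ 0 → ContDiff ℝ (⊤ : ℕ∞) g →
    (∀ y : E3, Laplacian.laplacian (fun z : E3 => ‖z‖ ^ l * g (inner ℝ a z / ‖z‖)) y = 0) →
    ∀ x : E3, x ≠ 0 → horizonL2 (horizonProfile l (fun z : E3 => ‖z‖ ^ l * g (inner ℝ a z / ‖z‖)) 0) 0 x = 0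

/-! ## The typed obstruction (negation lens) and the rung it feeds -/

/-- [CONJECTURE for general `l` — booked as such, no rung credit (V9-P4). DECIDED CELLS: l = 2 (`HorizonL2Quadrupole`, table);
l = 3 GLOBAL — DATUM B-ht1 (ns-wall-eng-7 g2, preregistered, jobs j316258/j316338): WORD = ZONAL-ONLY (SO(3)-slice ideal radical, lex GB
`{2a₄+3a₆²−3a₇², a₆(a₆²−4), a₆a₇, a₇(a₇²−4)}`, five rational points, all zonal; all 28 zonality minors in the radical); l = 4, 5, 6
ZONAL-ONLY exploratory (same exact method). Open: l ≥ 7 and the tower form.] HORIZON ZONALITY, single-degree form (conjecture beyond the verified cells; l = 2 is `HorizonL2Quadrupole`, l = 3 holds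
locally near the zonal cubic by the engine's Jacobian corank-3 computation): a degree-`l` solid harmonic whose horizon
profile is annihilated by `𝔏₂` is zonal about some axis. -/
def HorizonZonalitySingleDegree : Prop :=
  ∀ (l : ℕ) (H : E3 → ℝ), 2 ≤ l → ContDiff ℝ (⊤ : ℕ∞) H → (∀ (c : ℝ) (y : E3), H (c • y) = c ^ l * H y) →
    (∀ y, Laplacian.laplacian H y = 0) →
    (∀ x : E3, x ≠ 0 → horizonL2 (horizonProfile l H 0) 0 x = 0) →
    ∃ (a : E3) (g : ℝ → ℝ), a ≠ 0 ∧ ∀ y : E3, y ≠ 0 → H y = ‖y‖ ^ l * g (inner ℝ a y / ‖y‖)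

/-- [CONJECTURE — booked as such, no rung credit (V9-P4)] HORIZON ZONALITY, tower form (the typed obstruction; conjecture): a smooth scale-free unthreaded divergence-free profile
annihilated by the order-one AND order-two horizon laws has zonal radial part — i.e. every bounded unthreaded ancient flow
with a scale-free far field is asymptotically axisymmetric without swirl (or asymptotically constant). -/
def HorizonTowerZonality : Prop :=
  ∀ (U : E3 → E3) (x₀ : E3), ContDiffOn ℝ (⊤ : ℕ∞) U {x₀}ᶜ → IsZeroHomogeneousAbout x₀ U →
    (∀ x, x ≠ x₀ → Literature.Analysis.FluidPDE.VectorCalculus.divergence U x = 0) →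
    (∀ x, x ≠ x₀ → inner ℝ (curl U x) (x - x₀) = 0) →
    (∀ x, x ≠ x₀ → horizonL1 U x₀ x = 0) → (∀ x, x ≠ x₀ → horizonL2 U x₀ x = 0) →
    ∃ (a : E3) (g : ℝ → ℝ), a ≠ 0 ∧
      ∀ x, x ≠ x₀ → inner ℝ (U x) (x - x₀) = ‖x - x₀‖ * g (inner ℝ a (x - x₀) / ‖x - x₀‖)

/-- [v1 — SUPERSEDED per V9-P1 by `BoundedEndpointShellRungDatum` / `BoundedEndpointTailRung` below: an EXACT single-degree
slice at an INTERIOR time of an unthreaded window is not known to occur (single-degree exactness is not propagated), so this form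
risks being true for lack of instances; kept for the record.] BOUNDED-ENDPOINT SHELL RUNG (M–L given `OrderTwoHorizonLaw`; the W2 window rung at the non-decaying endpoint, all
degrees, no pressure normalisation beyond sublinear growth): a classical NS solution on an open window, unthreaded about `x₀`
at all times of the window, whose slice at `t₀` is a single-degree shell with a bounded-endpoint tail, has a horizon profile
annihilated by `𝔏₂` (hence zonal by the table / `HorizonZonalitySingleDegree`; for `l = 2`: axisymmetric, closing the
`σ = 1` cell of the g0 rung pressure-free). -/
def BoundedEndpointShellRung : Prop :=
  ∀ (S : Set ℝ) (u : ℝ → E3 → E3) (p : ℝ → E3 → ℝ) (x₀ : E3) (t₀ : ℝ) (l : ℕ) (H : E3 → ℝ) (h : ℝ → ℝ) (c : ℝ),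
    IsOpen S → t₀ ∈ S → Literature.Analysis.FluidPDE.IsClassicalNSSolutionOn S 1 0 u p →
    2 ≤ l → ContDiff ℝ (⊤ : ℕ∞) H → (∀ (a : ℝ) (y : E3), H (a • y) = a ^ l * H y) →
    (∀ y, Laplacian.laplacian H y = 0) → (∃ y, H y ≠ 0) →
    ContDiff ℝ (⊤ : ℕ∞) (fun y : E3 => h ‖y‖) → HasEndpointTail l h c →
    Tendsto (fun x : E3 => p t₀ x / (1 + ‖x - x₀‖)) (Filter.cocompact E3) (𝓝 0) →
    u t₀ = shellSlice h H x₀ →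
    (∀ t ∈ S, ∀ x, threadingFlux u x₀ t x = 0) →
    ∀ x : E3, x ≠ 0 → horizonL2 (horizonProfile l H 0) 0 x = 0

/-- BOUNDED-ENDPOINT SHELL RUNG, DATUM FORM (v2, V9-P1; M–L given a one-sided `OrderTwoHorizonLaw` at the initial time): a
classical NS solution on `[t₀, t₁)` (smooth up to `t₀`), unthreaded about `x₀` for `t ∈ (t₀, t₁)`, whose DATUM `u t₀` is the
single-degree shell with a bounded-endpoint tail and whose initial pressure grows sublinearly, has a horizon profile annihilated by
`𝔏₂`.  NON-VACUITY: exact shell DATA are freely prescribable (bounded smooth data launch classical solutions on a short window), and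
the hypothesis class is NON-EMPTY — every ZONAL `H` (uniaxial for `l = 2`) gives an axisymmetric swirl-free datum whose evolution
stays axisymmetric swirl-free, hence unthreaded about every axis point; the rung excludes the non-zonal data (instances on both
sides).  Proof route: `F ≡ 0` on `[t₀,t₁)` ⇒ the one-sided jet `∂ₜ²F(t₀⁺) ≡ 0`; the far-field form of `(u t₀, p t₀)` is that of
`OrderTwoHorizonLaw` with `U = c · horizonProfile l H`, so `0 = lim ρ² ∂ₜ²F = c³ 𝔏₂[U_H]` (`𝔏₂` is cubic in `U`). -/
def BoundedEndpointShellRungDatum : Prop :=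
  ∀ (u : ℝ → E3 → E3) (p : ℝ → E3 → ℝ) (x₀ : E3) (t₀ t₁ : ℝ) (l : ℕ) (H : E3 → ℝ) (h : ℝ → ℝ) (c : ℝ),
    t₀ < t₁ → Literature.Analysis.FluidPDE.IsClassicalNSSolutionOn (Set.Ico t₀ t₁) 1 0 u p →
    2 ≤ l → ContDiff ℝ (⊤ : ℕ∞) H → (∀ (a : ℝ) (y : E3), H (a • y) = a ^ l * H y) →
    (∀ y, Laplacian.laplacian H y = 0) → (∃ y, H y ≠ 0) →
    ContDiff ℝ (⊤ : ℕ∞) (fun y : E3 => h ‖y‖) → HasEndpointTail l h c →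
    Tendsto (fun x : E3 => p t₀ x / (1 + ‖x - x₀‖)) (Filter.cocompact E3) (𝓝 0) →
    u t₀ = shellSlice h H x₀ →
    (∀ t ∈ Set.Ioo t₀ t₁, ∀ x, threadingFlux u x₀ t x = 0) →
    ∀ x : E3, x ≠ 0 → horizonL2 (horizonProfile l H 0) 0 x = 0

/-- BOUNDED-ENDPOINT TAIL RUNG (v2, V9-P1's own repair; a COROLLARY of `OrderTwoHorizonLaw`): interior time of an open unthreaded
window, the slice only ASYMPTOTIC to a single-degree horizon profile — `u(t₀) = c·U_H + O(r^{−δ})` with six derivatives,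
`p(t₀) = P₀ + s₀ log r + O(r^{−δ})` with two — then `𝔏₂[U_H] ≡ 0`.  WITNESS CLASS (named, as asked): axisymmetric swirl-free
classical solutions launched from data equal to `c·U_H` with `H` ZONAL outside a ball — unthreaded about axis points on their window,
and (formally: the correction solves a forced problem with `O(r^{−1})` forcing `(U·∇)U + ∇P₀ − ΔU`, so `u(t) − c·U_H = O(t r^{−1})`) far
field preserved with `δ = 1`; the tail persistence is a CLAIM TO BE CHECKED, flagged, not assumed proved. -/
def BoundedEndpointTailRung : Prop :=
  ∀ (S : Set ℝ) (u : ℝ → E3 → E3) (p : ℝ → E3 → ℝ) (x₀ : E3) (t₀ : ℝ) (l : ℕ) (H : E3 → ℝ) (P₀ : E3 → ℝ) (c s₀ δ C : ℝ),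
    IsOpen S → t₀ ∈ S → Literature.Analysis.FluidPDE.IsClassicalNSSolutionOn S 1 0 u p → 0 < δ → c ≠ 0 →
    2 ≤ l → ContDiff ℝ (⊤ : ℕ∞) H → (∀ (a : ℝ) (y : E3), H (a • y) = a ^ l * H y) →
    (∀ y, Laplacian.laplacian H y = 0) → (∃ y, H y ≠ 0) →
    ContDiffOn ℝ (⊤ : ℕ∞) P₀ {x₀}ᶜ → (∀ a : ℝ, 0 < a → ∀ y : E3, P₀ (x₀ + a • y) = P₀ (x₀ + y)) →
    (∀ k ≤ 6, ∀ x : E3, 1 ≤ ‖x - x₀‖ →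
        ‖iteratedFDeriv ℝ k (fun z => u t₀ z - c • horizonProfile l H x₀ z) x‖ ≤ C * ‖x - x₀‖ ^ (-((k : ℝ) + δ))) →
    (∀ k ≤ 2, ∀ x : E3, 1 ≤ ‖x - x₀‖ →
        ‖iteratedFDeriv ℝ k (fun z => p t₀ z - P₀ z - s₀ * Real.log ‖z - x₀‖) x‖ ≤ C * ‖x - x₀‖ ^ (-((k : ℝ) + δ))) →
    (∀ t ∈ S, ∀ x, threadingFlux u x₀ t x = 0) →
    ∀ x : E3, x ≠ x₀ → horizonL2 (horizonProfile l H x₀) x₀ x = 0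


/-! ## Two-shell towers at order one (appended 2026-08-29 by ns-wall-eng-3 g3 at the critic's price MX-1; statements only —
the theorems `twoShellBracketZonality` / `twoShellHorizonTowerZonality` live in `Theorems/ThreadingFluxHorizonTowerTwoShell*.lean`) -/

/-- TWO-SHELL ZONALITY, BRACKET FORM (finite-dimensional algebra; THEOREM `Zonal.mixedDegreeBracketRigidity`,
`Theorems/ThreadingFluxHorizonTowerMixedDegreeRigidity.lean`, closes it by name): two nonzero solid harmonics `A ∈ 𝓗_l`,
`B ∈ 𝓗_m` of DIFFERENT degrees `l ≠ m` (`l, m ≥ 1`) whose bracket `⟪y, ∇A × ∇B⟫` vanishes identically are zonal about ONE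
COMMON axis (hypotheses in the vocabulary of `HorizonZonalitySingleDegree`; conclusion = its zonal form for both shells with the
same axis `a`).  With the same-degree rigidity (`LoopLaw.sameDegreeBracketRigidity`: `l = m` ⇒ `B ∈ ℝA`) this classifies the
Poisson-commuting pairs of solid harmonics on the spheres about the centre. -/
def TwoShellBracketZonality : Prop :=
  ∀ (l m : ℕ) (A B : E3 → ℝ), 1 ≤ l → 1 ≤ m → l ≠ m →
    ContDiff ℝ (⊤ : ℕ∞) A → (∀ (c : ℝ) (y : E3), A (c • y) = c ^ l * A y) → (∀ y, Laplacian.laplacian A y = 0) →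
    ContDiff ℝ (⊤ : ℕ∞) B → (∀ (c : ℝ) (y : E3), B (c • y) = c ^ m * B y) → (∀ y, Laplacian.laplacian B y = 0) →
    (∃ y, A y ≠ 0) → (∃ y, B y ≠ 0) →
    (∀ x : E3, inner ℝ x (cross (gradient A x) (gradient B x)) = 0) →
    ∃ (a : E3) (gA gB : ℝ → ℝ), a ≠ 0 ∧
      (∀ y : E3, y ≠ 0 → A y = ‖y‖ ^ l * gA (inner ℝ a y / ‖y‖)) ∧
      (∀ y : E3, y ≠ 0 → B y = ‖y‖ ^ m * gB (inner ℝ a y / ‖y‖))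

/-- TWO-SHELL HORIZON TOWER ZONALITY AT ORDER ONE = the TWO-SHELL CASE of the conjecture `HorizonTowerZonality` (l.261), decided by
the ORDER-ONE law alone (`𝔏₂` not needed): if the scale-free two-shell tower `U = U_{A} + U_{B}` (`U_H = horizonProfile · H 0`, the
horizon profiles of nonzero solid harmonics `A ∈ 𝓗_l`, `B ∈ 𝓗_m`, `l ≠ m`, `l, m ≥ 1`) is annihilated by `𝔏₁` off the centre, then
both shells are zonal about one common axis (the tower is axisymmetric without swirl).  Bridge to the bracket form: by
`OrderOneSphereEuler` with `f = l(l+1)A/rˡ + m(m+1)B/rᵐ`, `Φ = 2A/rˡ + 2B/rᵐ` (conjuncts (4)–(5) of `HorizonProfileStructure`),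
`𝔏₁[U](x) = −2 (l(l+1) − m(m+1)) ‖x‖^{1−l−m} ⟪x, ∇A × ∇B⟫` for `x ≠ 0`.  A single shell always passes order one (conjunct (6) of
`HorizonProfileStructure`), so the nonvanishing of BOTH shells is needed. -/
def TwoShellHorizonTowerZonality : Prop :=
  ∀ (l m : ℕ) (A B : E3 → ℝ), 1 ≤ l → 1 ≤ m → l ≠ m →
    ContDiff ℝ (⊤ : ℕ∞) A → (∀ (c : ℝ) (y : E3), A (c • y) = c ^ l * A y) → (∀ y, Laplacian.laplacian A y = 0) →
    ContDiff ℝ (⊤ : ℕ∞) B → (∀ (c : ℝ) (y : E3), B (c • y) = c ^ m * B y) → (∀ y, Laplacian.laplacian B y = 0) →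
    (∃ y, A y ≠ 0) → (∃ y, B y ≠ 0) →
    (∀ x : E3, x ≠ 0 → horizonL1 (fun z => horizonProfile l A 0 z + horizonProfile m B 0 z) 0 x = 0) →
    ∃ (a : E3) (gA gB : ℝ → ℝ), a ≠ 0 ∧
      (∀ y : E3, y ≠ 0 → A y = ‖y‖ ^ l * gA (inner ℝ a y / ‖y‖)) ∧
      (∀ y : E3, y ≠ 0 → B y = ‖y‖ ^ m * gB (inner ℝ a y / ‖y‖))


/-! ## Dipole towers at order one (appended 2026-08-29 by ARM A ns-exp-scalarLiouville g6, director KEY 05:03:18Z, critic size/strike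
check ns-wall-crit-1 g4 05:01:51Z: NO STRIKE, size M; statement only — the theorem `dipoleTowerHorizonZonality_of` lives in
`Theorems/ThreadingFluxHorizonTowerDipoleTowerOrderOne.lean`, the by-name inhabitant in `…DipoleTowerByName.lean`) -/

/-- DIPOLE TOWERS AT ORDER ONE = the THREE-SHELL CASE `{1, m, n}` (one shell the dipole, `m, n` not both odd) of the conjecture
`HorizonTowerZonality` (l.261), decided by the ORDER-ONE law alone: a scale-free three-shell tower `U_A + U_B + U_C` with `A ∈ 𝓗_1`
(dipole), `B ∈ 𝓗_m`, `C ∈ 𝓗_n`, `2 ≤ m, n`, `m ≠ n`, `m, n` NOT BOTH ODD, all shells non-zero, annihilated by the order-one horizon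
law `𝔏₁` off the centre, is coaxially zonal (axisymmetric without swirl about one common axis).  Shaped exactly like
`TwoShellHorizonTowerZonality` with a third shell.  (Parity bookkeeping: under `x ↦ −x` the pair term `(j,k)` of `𝔏₁` has sign
`(−1)^{j+k}`, so `𝔏₁ ≡ 0` splits into the classes `j + k` even / odd; «not both odd» is exactly the condition that one class is a single
pair.  The both-odd towers `{1, m, n}` are NOT claimed.) -/
def DipoleTowerHorizonZonality : Prop :=
  ∀ (m n : ℕ) (A B C : E3 → ℝ), 2 ≤ m → 2 ≤ n → m ≠ n → (Even m ∨ Even n) →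
    ContDiff ℝ (⊤ : ℕ∞) A → (∀ (c : ℝ) (y : E3), A (c • y) = c ^ 1 * A y) → (∀ y, Laplacian.laplacian A y = 0) →
    ContDiff ℝ (⊤ : ℕ∞) B → (∀ (c : ℝ) (y : E3), B (c • y) = c ^ m * B y) → (∀ y, Laplacian.laplacian B y = 0) →
    ContDiff ℝ (⊤ : ℕ∞) C → (∀ (c : ℝ) (y : E3), C (c • y) = c ^ n * C y) → (∀ y, Laplacian.laplacian C y = 0) →
    (∃ y, A y ≠ 0) → (∃ y, B y ≠ 0) → (∃ y, C y ≠ 0) →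
    (∀ x : E3, x ≠ 0 →
      horizonL1 (fun z => horizonProfile 1 A 0 z + horizonProfile m B 0 z + horizonProfile n C 0 z) 0 x = 0) →
    ∃ (a : E3) (gA gB gC : ℝ → ℝ), a ≠ 0 ∧
      (∀ y : E3, y ≠ 0 → A y = ‖y‖ ^ 1 * gA (inner ℝ a y / ‖y‖)) ∧
      (∀ y : E3, y ≠ 0 → B y = ‖y‖ ^ m * gB (inner ℝ a y / ‖y‖)) ∧
      (∀ y : E3, y ≠ 0 → C y = ‖y‖ ^ n * gC (inner ℝ a y / ‖y‖))


end Summit.NavierStokesRegularity.NavierStokesRegularity.Theorems.PoloidalLiouville.HorizonTower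

end
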